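import Literature.NumberTheory.EllipticCurves.CastellaGrossiSkinner2025.TwoLineEulerCharacteristic
import Literature.NumberTheory.EllipticCurves.CastellaGrossiSkinner2025.PerrinRiouMainConjectureProofs
import Literature.NumberTheory.EllipticCurves.CastellaGrossiSkinner2025.IsogenyInvariance
import Literature.NumberTheory.EllipticCurves.CastellaGrossiSkinner2025.GreenbergPAdicLFunction
import Literature.NumberTheory.EllipticCurves.CastellaGrossiLeeSkinner2022.AnticyclotomicControlTorsionFree
import Literature.NumberTheory.EllipticCurves.CastellaGrossiLeeSkinner2022.IMC2DivisibilityAndBDPValueFrame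
import Literature.NumberTheory.EllipticCurves.KellerYin2024.AnomalousAnticyclotomicMainConjecture
import Literature.NumberTheory.EllipticCurves.NonvanishingTwistsBumpFriedbergHoffstein
import Literature.NumberTheory.EllipticCurves.Rank1Residual.X1MainConjecture
import Literature.NumberTheory.EllipticCurves.AtkinLehnerFrickeLevelProofs
import Literature.NumberTheory.EllipticCurves.AnalyticRankModularityProofs
import Literature.NumberTheory.EllipticCurves.YanZhu2026.GreenbergMainTheoremsAnyRootGuarded
import Literature.NumberTheory.EllipticCurves.YanZhu2026.GreenbergDivisibilityProofs
import Literature.NumberTheory.EllipticCurves.YanZhu2026.TwistGoodOrdinaryProofs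
import Literature.NumberTheory.EllipticCurves.KatoRankBoundProofs
import Summits.BirchSwinnertonDyer.BirchSwinnertonDyer.Theorems.SmallImageMuTransferMuZeroCMKatzFrame
import Summits.BirchSwinnertonDyer.BirchSwinnertonDyer.Theorems.EisensteinPrimesTwoVariableGeneratorPair
import Summits.BirchSwinnertonDyer.BirchSwinnertonDyer.Theorems.SignedBaseChangeTwistPairGreenbergProductDivisibilityStubFrameData
import Summits.BirchSwinnertonDyer.Rank1Residual.X11b.KolyvaginHpointsAssembly
import Literature.NumberTheory.EllipticCurves.ZpExtensionUnitTwistProofs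
import Literature.NumberTheory.EllipticCurves.ZpExtensionAnticyclotomicHoldsProofs
import Summits.BirchSwinnertonDyer.Rank1Residual.X1.GoodLatticeExists
import Summits.BirchSwinnertonDyer.Rank1Residual.X1.KellerYinGoodLattice
import Summits.BirchSwinnertonDyer.Rank1Residual.Partition.AnticyclotomicControlJSWEmbAt
import Literature.NumberTheory.EllipticCurves.IsogenyGroundFieldExtension
import Literature.NumberTheory.EllipticCurves.IsogenyMordellWeilRankProofs
import Literature.NumberTheory.EllipticCurves.SelmerCorankIsogenyProofs
import Literature.NumberTheory.EllipticCurves.IwasawaLeadingTermProofs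
import Literature.NumberTheory.EllipticCurves.HeegnerPointsClassesProofs
import Literature.NumberTheory.EllipticCurves.HeegnerPointsRationalityGeneralLevelProofs
import Literature.NumberTheory.EllipticCurves.HeegnerPointsImaginaryQuadraticProofs
import Literature.NumberTheory.QuadraticFields.HeegnerCondition
import Literature.NumberTheory.EllipticCurves.Rubin1991.TwoVariableCMLines
import Literature.NumberTheory.EllipticCurves.AnticyclotomicRankinSelbergPAdicLFunction
import Literature.NumberTheory.EllipticCurves.ModularityVersionApProofs
import Literature.NumberTheory.EllipticCurves.ModularCurveManinSemistableBridgeProofs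
import Summits.BirchSwinnertonDyer.BirchSwinnertonDyer.Theorems.SignedBaseChangeK2RDivisibilityDescent
import Literature.NumberTheory.EllipticCurves.IsogenySelmerInfty
import Literature.NumberTheory.EllipticCurves.GreenbergVatsal2000.GreenbergSelmerGroups
import Literature.NumberTheory.EllipticCurves.Castella2018.AnticyclotomicSelmerDualModuleFinite
import Literature.NumberTheory.EllipticCurves.IwasawaDualFunctorialityProofs
import Literature.NumberTheory.EllipticCurves.IsogenyDualProofs
import Literature.NumberTheory.EllipticCurves.Kato2004.DivisibilityInputsZetaLine
import Literature.NumberTheory.EllipticCurves.KatoDivisibilityColemanKernelSkeletonProofs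
import Summits.BirchSwinnertonDyer.BirchSwinnertonDyer.Theorems.EisensteinPrimesMazurMCOnX1RankZeroInterludeSelmerIsogenyKernels
import HarnessLib.Audit.Tags
import HarnessLib

/-!
# Crux `MazurMCOnX1RankZero` (item stmt-BirchSwinnertonDyer-19035), line `interlude_with_torsion`: the CURRENCIES of the
# skeleton of record (v8) as tree definitions — `Theorems/…InterludeDefs`

Cell `bsd-eis` (host `run/shared/lean/pub/bsd-eis/`), LEAD `cruxlead-19035` (g0); `--supports` stmt-BirchSwinnertonDyer-19035.
A DEFINITIONS file (reviewed lane): the `Prop` currencies, the two structures `NodeHyp` / `FrameData` and the predicate `NodeConcl`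
of the line's skeleton `Cruxes/MazurMCOnX1RankZero/Lines/interlude_with_torsion.lean` v8 (authors: LEAD bsd-line-x1-p2 for v7's three
currencies; ideator bsd-idea-11 g6–g15 for the split's currencies; verbatim), moved into the tree so that (i) the line's sorry-free
recomposition (frame existence, S1⁺ ⊕ GV, XI-elimination, ISO, Steps 2–3 core, the descent `K_∞⁺ → ℚ_∞`) can be landed as
Theorems files and the crux obtains a BY-NAME conditional closure in the tree whose hypotheses are token-identical to the five
registered stubs, and (ii) a registered stub whose signature is a currency NAME (`stub_residualGL1FinitenessOdd :
ResidualGL1FinitenessOdd`, `stub_roadBResidueP : RoadBResidueP`, …) can be closed by a Theorems file with that verbatim header.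
NOTHING is asserted: every `def … : Prop` below is an obligation node (`@[conjecture]`: open in the tree — dischargeable only by a
theorem, never assumed elsewhere); one of them, `XGrIsogenyInvariantAwayFromP` (K2⁺-e), IS already a theorem of the tree in unfolded
form (`xGrIsogenyInvariantAwayFromP` of `Theorems/…InterludeSelmerIsogenyKernels.lean`; folded `_holds` in the companion proof file). `PublishedFacts` / `PublishedFactsII` are conjunctions of refereed Literature named
facts BY NAME (open in the tree only in the sense that their `_holds` theorems are not proved). No summit statement (BSD, Mazur's MC,
IMC2), no crux and no stub is proved by this file. Docstrings: the skeleton's, verbatim (long forms: the card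
`Lines/interlude_stepsTwoThree_split_idea11g6.md` and the memos named there).
[cite: CastellaGrossiSkinner2025, §5 (Interlude), Prop. 4.2.1, Cor. 4.1.3, Prop. 2.4.5, Prop. 3.3.1, Prop. 3.2.3, Prop. 3.4.2, Thm. 7.2.3]
[cite: YanZhu2024MainConjNonCM, Thm. 3.9, Def. 3.11, Prop. 3.14] [cite: KellerYin2024, Thm. 3.0.8] [cite: KobayashiOta2020, Prop. 2.9]
[cite: GreenbergLNM1716, §1, §5 Prop. 5.10] [cite: PerrinRiou1989ASPM, Théorème (p. 349)] [cite: Wuthrich2014, Thm. 16]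
-/

set_option linter.dupNamespace false
set_option autoImplicit false

noncomputable section

open scoped Classical MatrixGroups ModularForm

open CongruenceSubgroup WeierstrassCurve NumberField IsDedekindDomain Field
  Literature.NumberTheory.EllipticCurves Literature.NumberTheory.EllipticCurves.ModularForms
  Literature.NumberTheory.EllipticCurves.Rank1Residual Literature.NumberTheory.GaloisRepresentations
  Literature.NumberTheory.EllipticCurves.CyclotomicZp Literature.NumberTheory.EllipticCurves.Castella2018
  Literature.NumberTheory.QuadraticFields

namespace Summit.BirchSwinnertonDyer.BirchSwinnertonDyer.Theorems.InterludeWithTorsion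

/-! ## The three currencies of the line of record (copied verbatim from `Lines/interlude_with_torsion.lean` v7) -/

/-- v7 currency `PublishedFacts` (verbatim copy). [cite: Wuthrich2014, Thm. 16]
[cite: CastellaGrossiSkinner2025, Prop. 3.3.1, Prop. 3.2.3, Thm. 2.4.1, Thm. 2.4.2]
[cite: CastellaGrossiLeeSkinner2022, Thm. 5.1.1, Thm. 5.1.3] -/
@[conjecture] def PublishedFacts : Prop :=
  bumpFriedbergHoffstein_exists_heegnerField_split_twist_simpleZero ∧
  nonempty_modularParametrizationData ∧
  exists_isNewformOf ∧
  rank_eq_analyticRank_of_analyticRank_le_one ∧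
  CastellaGrossiSkinner2025.prop331_nonempty_linearEquiv_prod ∧
  Wuthrich2014.charIdeal_dvd_padicLFunction ∧
  CastellaGrossiSkinner2025.prop323_charGenerator_eq_of_isIsogenous ∧
  CastellaGrossiSkinner2025.thm242_lemma244_exists_isGreenbergLFunction ∧
  CastellaGrossiSkinner2025.thm241_exists_isHidaRankinLFunctionII ∧
  CastellaGrossiLeeSkinner2022.thm511_anticyclotomicControl_of_torsionFree ∧
  CastellaGrossiLeeSkinner2022.thm513_exists_isBDPLFunction_valueAtOne_disc

/-- v7 currency `MinusLineValueClass` (verbatim copy). [cite: KellerYin2024, Thm. 3.0.8] [cite: KobayashiOta2020, Prop. 2.9] -/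
@[conjecture] def MinusLineValueClass : Prop :=
  ∀ (W : WeierstrassCurve ℚ) [W.IsElliptic] [W.IsGloballyMinimal] (p : ℕ) [Fact p.Prime],
      2 < p → Good W p → Red W p → Anom W p →
      (∀ Φ : AddSubgroup (geomTorsion W (p : ℤ)), IsRationalLine W p Φ → ¬ LineUnramifiedAt W p Φ) →
      ∀ (K : Type) [Field K] [NumberField K], IsImaginaryQuadratic K →
        SatisfiesHeegnerHypothesis (W.conductorNorm ℤ) K → SatisfiesHeegnerHypothesis p K →
        Odd (NumberField.discr K) → NumberField.discr K ≠ -3 →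
        (∀ Q : (W.baseChange K).toAffine.Point, p • Q = 0 → Q = 0) →
        (W.baseChange K).selmerCorank p = 1 →
      ∀ (ι : K →+* ℚ_[p]) (v vbar : HeightOneSpectrum (𝓞 K)),
        (∀ x : 𝓞 K, x ∈ v.asIdeal ↔ ‖ι (x : K)‖ < 1) →
        ((p : ℕ) : 𝓞 K) ∈ vbar.asIdeal → vbar ≠ v →
      ∀ (κ : ZpExtension K p), κ.IsAnticyclotomic →
      ∀ (γ : absoluteGaloisGroup K) [Fact (κ.IsTopGenerator γ)],
      ∀ (N : ℕ) [NeZero N] (Dt : ModularParametrizationData W N)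
        (H : HeegnerDatum N (NumberField.discr K)) (ιC : K →+* ℂ) (P : (W.baseChange K).toAffine.Point),
        WeierstrassCurve.Affine.Point.map ιC.toRatAlgHom P = heegnerPointComplex Dt H →
      ∀ (W' : WeierstrassCurve ℚ) [W'.IsElliptic] [W'.IsGloballyMinimal], IsIsogenous W W' →
        Module.IsTorsion (IwasawaAlgebra p) (AcSelmer.XAc (W'.baseChange K) p κ vbar ∅ γ) ∧
        ∃ F : IwasawaAlgebra p,
          AcSelmer.XAc.charIdeal (W'.baseChange K) p κ vbar ∅ γ = Ideal.span {F} ∧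
          ∃ u : ℤ_[p]ˣ,
            ((PowerSeries.constantCoeff F : ℤ_[p]) : ℚ_[p]) =
              ((u : ℤ_[p]) : ℚ_[p]) * ((Dt.c : ℚ_[p])⁻¹) ^ 2 *
                (1 - (W.frobeniusTrace p : ℚ_[p]) * (p : ℚ_[p])⁻¹ + (p : ℚ_[p])⁻¹) ^ 2 *
                ((W.baseChange ℚ_[p]).padicLogPoint (formalIndex W p • padicPointOf W p ι P) /
                  (formalIndex W p : ℚ_[p])) ^ 2

/-- v7 currency `InterludeNodeAnom` (verbatim copy): the Interlude node over `K_∞⁺` at an anomalous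
Eisenstein prime. [cite: CastellaGrossiSkinner2025, §5 (Interlude) and Thm. 7.2.3] -/
@[conjecture] def InterludeNodeAnom : Prop :=
  ∀ (W : WeierstrassCurve ℚ) [W.IsElliptic] [W.IsGloballyMinimal] (p : ℕ) [Fact p.Prime],
    2 < p → Good W p → Red W p → Anom W p →
    ∀ (K : Type) [Field K] [NumberField K], IsImaginaryQuadratic K →
      SatisfiesHeegnerHypothesis (W.conductorNorm ℤ) K →
      Odd (NumberField.discr K) → NumberField.discr K ≠ -3 →
      ((Ideal.span {(p : ℤ)}).primesOver (𝓞 K)).ncard = 2 →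
      (W.baseChange K).mordellWeilRank = 1 →
      Finite (AddCommGroup.primaryComponent (W.baseChange K).sha p) →
    ∀ (κ : ZpExtension K p) (γ : Field.absoluteGaloisGroup K),
      κ.IsCyclotomic → κ.IsTopGenerator γ →
      (∃ ζ : ℤ_[p]ˣ, IsOfFinOrder ζ ∧
        ((GaloisRep.cyclotomicCharacter K p γ * ζ : ℤ_[p]ˣ) : ℤ_[p]) =
          (cyclotomicGenerator p : ℤ_[p])) →
    ∀ [NeZero (W.conductorNorm ℤ)] (f : CuspForm (Gamma0 (W.conductorNorm ℤ)) 2),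
      IsNewformOf W f → ∀ (ϖ : ℚ), (ϖ : ℝ) * W.realPeriodRat = plusPeriod f →
    ∀ (W' : WeierstrassCurve ℚ) [W'.IsElliptic] [W'.IsGloballyMinimal],
      (∃ C : VariableChange ℚ, C • W' = W.quadraticTwist (NumberField.discr K : ℚ)) →
    ∀ [NeZero (W'.conductorNorm ℤ)] (g : CuspForm (Gamma0 (W'.conductorNorm ℤ)) 2),
      IsNewformOf W' g → ∀ (ϖ' : ℚ), (ϖ' : ℝ) * W'.realPeriodRat = plusPeriod g →
    ∀ (D : (W.baseChange K).SelmerDualData κ γ),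
      D.IsTorsion ∧
      ∃ G : IwasawaAlgebra p, D.charIdeal = Ideal.span {G} ∧
        iwasawaToPowerSeries p G =
          PowerSeries.C ((ϖ * ϖ' : ℚ) : ℚ_[p]) *
            (padicLFunction f (unitRoot W p : ℚ_[p]) * padicLFunction g (unitRoot W' p : ℚ_[p]))

/-! ## New currencies of the split (all over existing carriers) -/

/-- **PUB-II**: the two further published inputs of Steps 2–3, by name — the Greenberg/Katz frame of the
isogeny class exists at every adapted pair of generators (Yan–Zhu Thm. 3.9 + Def. 3.11 = CGS Thm. 2.4.1,
Thm. 2.4.2, Def. 2.4.3, Lemma 2.4.4), and `𝓛_p^Gr(f/K)⁻ Λ^{ur,−} = 𝓛_p^BDP(f/K) Λ^{ur,−}` (Yan–Zhu Prop. 3.14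
= CGS Prop. 2.4.5) — the GUARDED re-vendoring `prop314_span_minus_eq_span_bdp_anyRoot_guarded` (period binder
`Ω ≠ 0 → δ² = ±d_K →`; the unguarded `∀`-over-frames form is mis-stated: tree theorem
`prop314_span_minus_eq_span_bdp_anyRoot.bdp_eq_zero_of_unguarded`, critic VERDICT #39 P1); `FrameData` carries
exactly the two guards (`Ω_ne`, `δ_sq`). [cite: YanZhu2024MainConjNonCM, Thm. 3.9, Def. 3.11, Prop. 3.14]
[cite: CastellaGrossiSkinner2025, Thm. 2.4.2, Lemma 2.4.4, Prop. 2.4.5] -/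
@[conjecture] def PublishedFactsII : Prop :=
  YanZhu2026.thm39_def311_exists_isGreenbergLFunctionAnyRoot₂ ∧
  YanZhu2026.prop314_span_minus_eq_span_bdp_anyRoot_guarded

/-- **The outer hypotheses of the Interlude node** at `(E, p, K, κ, γ)`: `p > 2` anomalous Eisenstein of good
reduction, `K` a Heegner field for `N_E` with `p` split, `D_K` odd `≠ −3`, `rank E(K) = 1`, `Ш(E/K)[p^∞]`
finite, `(κ, γ)` the normalised cyclotomic pair of `K` — exactly the binders of `InterludeNodeAnom` before
the newform. [cite: CastellaGrossiSkinner2025, §5 (Interlude), hypotheses (a), (b) and Thm. 7.2.3] -/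
structure NodeHyp (W : WeierstrassCurve ℚ) [W.IsElliptic] [W.IsGloballyMinimal] (p : ℕ) [Fact p.Prime]
    (K : Type) [Field K] [NumberField K] (κ : ZpExtension K p) (γ : absoluteGaloisGroup K) : Prop where
  two_lt : 2 < p
  good : Good W p
  red : Red W p
  anom : Anom W p
  iq : IsImaginaryQuadratic K
  heeg : SatisfiesHeegnerHypothesis (W.conductorNorm ℤ) K
  discr_odd : Odd (NumberField.discr K)
  discr_ne : NumberField.discr K ≠ -3
  split : ((Ideal.span {(p : ℤ)}).primesOver (𝓞 K)).ncard = 2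
  rank : (W.baseChange K).mordellWeilRank = 1
  sha : Finite (AddCommGroup.primaryComponent (W.baseChange K).sha p)
  cyc : κ.IsCyclotomic
  gen : κ.IsTopGenerator γ
  normalised : ∃ ζ : ℤ_[p]ˣ, IsOfFinOrder ζ ∧
    ((GaloisRep.cyclotomicCharacter K p γ * ζ : ℤ_[p]ˣ) : ℤ_[p]) = (cyclotomicGenerator p : ℤ_[p])

/-- **A Greenberg frame of the isogeny class over the `ℤ_p²`-extension of `K`** (CGS §2.4 / Yan–Zhu §3.4, in the tree's currency
`IsKatzMeasure₂` + `IsGreenbergLFunctionAnyRoot₂`; long form: memo Appendix H): an embedding datum `ι : ℚ̄_p ≅ ℂ` inducing `v`, the other prime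
`v̄`, the anticyclotomic `κ₂`, an ADAPTED pair of generators `(γ₁, γ₂)` with `κ γ₁ = κ γ` (the same variable `T` on the cyclotomic line), Katz's
measure `LK` and Greenberg's `G = 𝓛_v^Gr(f/K)` in `𝒪_{ℂ_p}⟦T₁⟧⟦T₂⟧`, and a structure map `J : ℤ_p → 𝒪_{ℂ_p}`; `UnrSeries₂.plus G` is then
`𝓛_p^Gr(f/K)⁺`. Data, not a claim; existence is `frameData_of_publishedII`. [cite: CastellaGrossiSkinner2025, Thm. 2.4.2, Def. 2.4.3, Lemma 2.4.4, §4.2 (TeX l. 1882–1889)]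
[cite: YanZhu2024MainConjNonCM, Thm. 3.9, Def. 3.11, §3.5 (Λ^ur → Λ^{ur,±}), Cor. 5.4] -/
structure FrameData (W : WeierstrassCurve ℚ) [W.IsGloballyMinimal] (p : ℕ) [Fact p.Prime]
    (K : Type) [Field K] [NumberField K] [NeZero (NumberField.discr K).natAbs]
    (κ : ZpExtension K p) (γ : absoluteGaloisGroup K) {N : ℕ} [NeZero N] (f : CuspForm (Gamma0 N) 2) where
  /-- the embedding datum `ℚ̄_p ≅ ℂ` -/
  ιC : PadicAlgCl p ≃+* ℂ
  /-- the prime `v ∣ p` induced by `ιC` -/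
  v : HeightOneSpectrum (𝓞 K)
  /-- the other prime `v̄ ∣ p` -/
  vbar : HeightOneSpectrum (𝓞 K)
  /-- the anticyclotomic `ℤ_p`-extension -/
  κ₂ : ZpExtension K p
  /-- adapted generator on the cyclotomic side (`γ₁ ∈ ker κ₂`) -/
  γ₁ : absoluteGaloisGroup K
  /-- adapted generator on the anticyclotomic side (`γ₂ ∈ ker κ`) -/
  γ₂ : absoluteGaloisGroup K
  setting : YanZhu2026.GreenbergSetting ιC W N K v vbar κ κ₂
  pair : ZpExtension.IsTopGeneratorPair κ κ₂ γ₁ γ₂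
  /-- `γ₁` and `γ` induce the same variable on `K_∞⁺` -/
  apply_eq : κ γ₁ = κ γ
  Ω : ℂ
  δ : ℂ
  Ωp : (unrIntegers p)ˣ
  /-- Katz's two-variable measure -/
  LK : PowerSeries (PowerSeries (PadicComplexInt p))
  /-- Greenberg's `𝓛_v^Gr(f/K)` -/
  G : PowerSeries (PowerSeries (PadicComplexInt p))
  Ω_ne : Ω ≠ 0
  δ_sq : δ ^ 2 = (NumberField.discr K : ℂ) ∨ δ ^ 2 = -(NumberField.discr K : ℂ)
  katz : IsKatzMeasure₂ ιC v vbar ∅ κ κ₂ γ₁⁻¹ γ₂⁻¹ 1 Ω δ ((Ωp : unrIntegers p) : ℂ_[p]) LK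
  green : IsGreenbergLFunctionAnyRoot₂ ιC v vbar κ κ₂ γ₁⁻¹ γ₂⁻¹ f (NumberField.discr K).natAbs
    (NumberField.classNumber K) LK G
  /-- the structure map `ℤ_p → 𝒪_{ℂ_p}` along which `char(X_Gr) Λ^ur` is read -/
  J : ℤ_[p] →+* PadicComplexInt p
  J_compat : ∀ x : ℤ_[p], ((J x : PadicComplexInt p) : ℂ_[p]) = ((x : ℚ_[p]) : ℂ_[p])

/-- **Frame existence** (plumbing): at the node, for the newform `f` of `E`, a `FrameData` exists.
(Yan–Zhu Thm. 3.9 / CGS Thm. 2.4.2 at an adapted pair through `(κ γ, 0)`; an embedding datum inducing a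
prime above the split `p`; `exists_ringHom_unrIntegers_padicComplexInt`-style structure map.)
[cite: CastellaGrossiSkinner2025, Thm. 2.4.2, Lemma 2.4.4] [cite: YanZhu2024MainConjNonCM, Thm. 3.9, Def. 3.11] -/
@[conjecture] def FrameDataExists : Prop :=
  ∀ (W : WeierstrassCurve ℚ) [W.IsElliptic] [W.IsGloballyMinimal] (p : ℕ) [Fact p.Prime]
    (K : Type) [Field K] [NumberField K] (κ : ZpExtension K p) (γ : absoluteGaloisGroup K),
    NodeHyp W p K κ γ →
    ∀ [NeZero (W.conductorNorm ℤ)] (f : CuspForm (Gamma0 (W.conductorNorm ℤ)) 2), IsNewformOf W f →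
    ∀ [NeZero (NumberField.discr K).natAbs], Nonempty (FrameData W p K κ γ f)

/-- **The node's conclusion block at a member `V` of the class, for the newform `f`** (the inner block of
`InterludeNodeAnom`, binder for binder, with the curve generalised): for every `ϖ` with `ϖ Ω_V = Ω_f⁺`, every
minimal model `V'` of `V^{D_K}` with newform `g` and `ϖ' Ω_{V'} = Ω_g⁺`, every ordinary dual datum `D` of
`V/K_∞⁺` is torsion with `char = (G₀)`, `ι G₀ = ϖϖ' L_p(f, α_V) L_p(g, α_{V'})`.
[cite: CastellaGrossiSkinner2025, Thm. 7.2.3 and §5 (Interlude)] -/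
def NodeConcl (V : WeierstrassCurve ℚ) [V.IsElliptic] [V.IsGloballyMinimal] (p : ℕ) [Fact p.Prime]
    (K : Type) [Field K] [NumberField K] (κ : ZpExtension K p) (γ : absoluteGaloisGroup K)
    {N : ℕ} (f : CuspForm (Gamma0 N) 2) : Prop :=
  ∀ (ϖ : ℚ), (ϖ : ℝ) * V.realPeriodRat = plusPeriod f →
  ∀ (V' : WeierstrassCurve ℚ) [V'.IsElliptic] [V'.IsGloballyMinimal],
    (∃ C : VariableChange ℚ, C • V' = V.quadraticTwist (NumberField.discr K : ℚ)) →
  ∀ [NeZero (V'.conductorNorm ℤ)] (g : CuspForm (Gamma0 (V'.conductorNorm ℤ)) 2),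
    IsNewformOf V' g → ∀ (ϖ' : ℚ), (ϖ' : ℝ) * V'.realPeriodRat = plusPeriod g →
  ∀ (D : (V.baseChange K).SelmerDualData κ γ),
    D.IsTorsion ∧
    ∃ G₀ : IwasawaAlgebra p, D.charIdeal = Ideal.span {G₀} ∧
      iwasawaToPowerSeries p G₀ =
        PowerSeries.C ((ϖ * ϖ' : ℚ) : ℚ_[p]) *
          (padicLFunction f (unitRoot V p : ℚ_[p]) * padicLFunction g (unitRoot V' p : ℚ_[p]))

/-- **S1⁺ ⊕ GV — the CHARACTERISTIC VALUE ON THE CYCLOTOMIC LINE EQUALS THE GREENBERG VALUE** (CGS §5 Step 1 read at `γ⁻ ↦ 1` with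
Prop. 2.4.5 and CGLS Thm. 5.1.3; PROVED as `plusCharValue_of_published`; long form: memo Appendix H): at the node, for a Greenberg frame and
every `K`-torsion-free member `V ∼ E`, `X_Gr(V/K_∞⁺)` (at the adapted `γ₁`) is `Λ`-torsion with `char = (F⁺)`, `F⁺(0) ≠ 0`, and
`|F⁺(0)|_p = |𝓛_p^Gr(f/K)(𝟙)|_p` (`= |G(0,0)|`): both sides are `#(ℤ_p / 𝓕_ac(0))`. Hypotheses: v7's `PublishedFacts`, `PublishedFactsII`,
CGS Prop. 3.4.2, `MinusLineValueClass`. [cite: CastellaGrossiSkinner2025, §5 Step 1 and Step 3 (TeX l. 2089–2098, 2121–2124), Prop. 2.4.5, Prop. 3.4.2]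
[cite: CastellaGrossiLeeSkinner2022, Thm. 5.1.3] [cite: YanZhu2024MainConjNonCM, Prop. 3.14] -/
@[conjecture] def PlusCharValueEqGreenbergValue : Prop :=
  ∀ (W : WeierstrassCurve ℚ) [W.IsElliptic] [W.IsGloballyMinimal] (p : ℕ) [Fact p.Prime]
    (K : Type) [Field K] [NumberField K] (κ : ZpExtension K p) (γ : absoluteGaloisGroup K),
    NodeHyp W p K κ γ →
    ∀ [NeZero (W.conductorNorm ℤ)] (f : CuspForm (Gamma0 (W.conductorNorm ℤ)) 2), IsNewformOf W f →
    ∀ [NeZero (NumberField.discr K).natAbs] (Φ : FrameData W p K κ γ f) [Fact (κ.IsTopGenerator Φ.γ₁)],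
    ∀ (V : WeierstrassCurve ℚ) [V.IsElliptic] [V.IsGloballyMinimal], IsIsogenous W V →
      (∀ Q : (V.baseChange K).toAffine.Point, p • Q = 0 → Q = 0) →
      Module.IsTorsion (IwasawaAlgebra p) (AcSelmer.XAc (V.baseChange K) p κ Φ.vbar ∅ Φ.γ₁) ∧
      ∃ F : IwasawaAlgebra p,
        AcSelmer.XAc.charIdeal (V.baseChange K) p κ Φ.vbar ∅ Φ.γ₁ = Ideal.span {F} ∧
        PowerSeries.constantCoeff F ≠ 0 ∧
        ‖(((PowerSeries.constantCoeff F : ℤ_[p]) : ℚ_[p]) : ℂ_[p])‖ =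
          ‖((PowerSeries.constantCoeff (UnrSeries₂.plus Φ.G) : PadicComplexInt p) : ℂ_[p])‖

/-- **XI — THE TWO DIVISIBILITY TRANSFERS OF `prop:equiv` AT A `K`-TORSION-FREE LATTICE** (CGS Prop. 4.2.1 with `α = 𝟙`, as used
in §5 Steps 2 and 3, TeX l. 2105–2107, 2126–2128; PRE rider ⇐ Cor. 4.1.3 ⇐ Thm. 4.1.1 ⇐ BSTW §5; long form: memo Appendix H). At the node,
for a Greenberg frame `(…, γ₁, G, J)`, there is a member `V ∼ E` with good reduction, reducible `E[p]`, (Heeg) for `N_V` and `V(K)[p] = 0`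
(print: Wüthrich's `E_•` when `E_•(K)[p] = 0`) such that — whenever `𝓛_p^Gr(f/K)⁺ ≠ 0` — for every companion `(V', g, ϖ, ϖ', D, G₀)` with
`ι G₀ = ϖϖ' L_p(f, α_V) L_p(g, α_{V'})` (`= 𝓛_p^PR(V/K)⁺`, Prop. 2.2.4): (⊇) `X_ord` torsion and `G₀ ∈ char X_ord(V/K_∞⁺)` ⟹
`(𝓛_Gr⁺) ⊆ char(X_Gr(V/K_∞⁺)) Λ^ur`; (⊆) `X_Gr(V/K_∞⁺)` torsion and `char(X_Gr) Λ^ur ⊆ (𝓛_Gr⁺)` ⟹ `char X_ord(V/K_∞⁺) ⊆ (G₀)`.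
WHY IT MIGHT FAIL: on rows `E_•(K)[p] ≠ 0` the torsion-free member is not `E_•` and the statement is print only after a
cyclotomic-line isogeny transport (K2⁺). [cite: CastellaGrossiSkinner2025, Prop. 4.2.1, Cor. 4.1.3, Thm. 4.1.1, §5 Steps 2–3, Prop. 2.2.4]
[cite: BurungaleSkinnerTianWan2024, §5 (arXiv:2409.01350)] -/
@[conjecture] def CrossTransferAtTorsionFreeLattice : Prop :=
  ∀ (W : WeierstrassCurve ℚ) [W.IsElliptic] [W.IsGloballyMinimal] (p : ℕ) [Fact p.Prime]
    (K : Type) [Field K] [NumberField K] (κ : ZpExtension K p) (γ : absoluteGaloisGroup K),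
    NodeHyp W p K κ γ →
    ∀ [NeZero (W.conductorNorm ℤ)] (f : CuspForm (Gamma0 (W.conductorNorm ℤ)) 2), IsNewformOf W f →
    ∀ [NeZero (NumberField.discr K).natAbs] (Φ : FrameData W p K κ γ f) [Fact (κ.IsTopGenerator Φ.γ₁)],
    ∃ (V : WeierstrassCurve ℚ) (_ : V.IsElliptic) (_ : V.IsGloballyMinimal),
      IsIsogenous W V ∧ Good V p ∧ Red V p ∧ SatisfiesHeegnerHypothesis (V.conductorNorm ℤ) K ∧
      (∀ Q : (V.baseChange K).toAffine.Point, p • Q = 0 → Q = 0) ∧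
      (UnrSeries₂.plus Φ.G ≠ 0 →
        ∀ (V' : WeierstrassCurve ℚ) [V'.IsElliptic] [V'.IsGloballyMinimal],
          (∃ C : VariableChange ℚ, C • V' = V.quadraticTwist (NumberField.discr K : ℚ)) →
        ∀ [NeZero (V'.conductorNorm ℤ)] (g : CuspForm (Gamma0 (V'.conductorNorm ℤ)) 2), IsNewformOf V' g →
        ∀ (ϖ : ℚ), (ϖ : ℝ) * V.realPeriodRat = plusPeriod f →
        ∀ (ϖ' : ℚ), (ϖ' : ℝ) * V'.realPeriodRat = plusPeriod g →
        ∀ (D : (V.baseChange K).SelmerDualData κ γ) (G₀ : IwasawaAlgebra p),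
          iwasawaToPowerSeries p G₀ =
            PowerSeries.C ((ϖ * ϖ' : ℚ) : ℚ_[p]) *
              (padicLFunction f (unitRoot V p : ℚ_[p]) * padicLFunction g (unitRoot V' p : ℚ_[p])) →
          (D.IsTorsion → G₀ ∈ D.charIdeal →
            Ideal.span {UnrSeries₂.plus Φ.G} ≤
              (AcSelmer.XAc.charIdeal (V.baseChange K) p κ Φ.vbar ∅ Φ.γ₁).map (PowerSeries.map Φ.J)) ∧
          (Module.IsTorsion (IwasawaAlgebra p) (AcSelmer.XAc (V.baseChange K) p κ Φ.vbar ∅ Φ.γ₁) →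
            (AcSelmer.XAc.charIdeal (V.baseChange K) p κ Φ.vbar ∅ Φ.γ₁).map (PowerSeries.map Φ.J) ≤
              Ideal.span {UnrSeries₂.plus Φ.G} →
            D.charIdeal ≤ Ideal.span {G₀}))

/-- **XI′ — THE FOUR-TERM IDENTITIES OF `prop:equiv` AT A `K`-TORSION-FREE LATTICE** (rev 4: the PRE atom ONE LEVEL UP — the
displayed consequence of CGS Thm. 4.1.1 / Cor. 4.1.3 (`BF⁺ ∈ 𝔖_{ord,rel}(V/K_∞⁺)` and its two explicit reciprocity laws) through the
Poitou–Tate sequences (PT1)/(PT2) of the PROOF of Prop. 4.2.1 at `α = 𝟙`, TeX l. 1913–1941; long form: memo Appendix H). At the node,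
for a Greenberg frame `(…, γ₁, G, J)`, there is a member `V ∼ E` with `Good/Red/Heeg(N_V)` and `V(K)[p] = 0` such that, when
`𝓛^Gr⁺ = plus G ≠ 0`, for every companion `(V', g, ϖ, ϖ', D, G₀)` (`ι G₀ = 𝓛^PR(V/K)⁺`): if `X_ord(V/K_∞⁺)` (`= D`) OR `X_Gr(V/K_∞⁺)`
(`= XAc … v̄ ∅ γ₁`) is `Λ`-torsion then BOTH are, and there are `a, b ∈ Λ ∖ 0` with `(G₀ b) = (a)·char D` in `Λ` and
`(plus G · J b) = (J a)·(char XAc)Λ^{ur}` in `𝓞⟦T⟧`. `V(K)[p] = 0` enters ONLY to kill the compact `𝔖_{str,rel}`, `𝔖_ord`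
(`H¹(K_Σ/K, T ⊗ Λ)` torsion-free as `K_∞⁺/K` is pro-`p`). PRE rider as for XI (⇐ Cor. 4.1.3 ⇐ Thm. 4.1.1 ⇐ BSTW §5); print's curve is `E_•`.
[cite: CastellaGrossiSkinner2025, Prop. 4.2.1 (proof: (PT1), (PT2), (cc)), Cor. 4.1.3, Thm. 4.1.1]
[cite: BurungaleSkinnerTianWan2024, §5] [cite: KingsLoefflerZerbes2017, explicit reciprocity laws] -/
@[conjecture] def FourTermAtTorsionFreeLattice : Prop :=
  ∀ (W : WeierstrassCurve ℚ) [W.IsElliptic] [W.IsGloballyMinimal] (p : ℕ) [Fact p.Prime]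
    (K : Type) [Field K] [NumberField K] (κ : ZpExtension K p) (γ : absoluteGaloisGroup K),
    NodeHyp W p K κ γ →
    ∀ [NeZero (W.conductorNorm ℤ)] (f : CuspForm (Gamma0 (W.conductorNorm ℤ)) 2), IsNewformOf W f →
    ∀ [NeZero (NumberField.discr K).natAbs] (Φ : FrameData W p K κ γ f) [Fact (κ.IsTopGenerator Φ.γ₁)],
    ∃ (V : WeierstrassCurve ℚ) (_ : V.IsElliptic) (_ : V.IsGloballyMinimal),
      IsIsogenous W V ∧ Good V p ∧ Red V p ∧ SatisfiesHeegnerHypothesis (V.conductorNorm ℤ) K ∧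
      (∀ Q : (V.baseChange K).toAffine.Point, p • Q = 0 → Q = 0) ∧
      (UnrSeries₂.plus Φ.G ≠ 0 →
        ∀ (V' : WeierstrassCurve ℚ) [V'.IsElliptic] [V'.IsGloballyMinimal],
          (∃ C : VariableChange ℚ, C • V' = V.quadraticTwist (NumberField.discr K : ℚ)) →
        ∀ [NeZero (V'.conductorNorm ℤ)] (g : CuspForm (Gamma0 (V'.conductorNorm ℤ)) 2), IsNewformOf V' g →
        ∀ (ϖ : ℚ), (ϖ : ℝ) * V.realPeriodRat = plusPeriod f →
        ∀ (ϖ' : ℚ), (ϖ' : ℝ) * V'.realPeriodRat = plusPeriod g →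
        ∀ (D : (V.baseChange K).SelmerDualData κ γ) (G₀ : IwasawaAlgebra p),
          iwasawaToPowerSeries p G₀ =
            PowerSeries.C ((ϖ * ϖ' : ℚ) : ℚ_[p]) *
              (padicLFunction f (unitRoot V p : ℚ_[p]) * padicLFunction g (unitRoot V' p : ℚ_[p])) →
          (D.IsTorsion ∨
              Module.IsTorsion (IwasawaAlgebra p) (AcSelmer.XAc (V.baseChange K) p κ Φ.vbar ∅ Φ.γ₁)) →
          D.IsTorsion ∧
            Module.IsTorsion (IwasawaAlgebra p) (AcSelmer.XAc (V.baseChange K) p κ Φ.vbar ∅ Φ.γ₁) ∧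
            ∃ a b : IwasawaAlgebra p, a ≠ 0 ∧ b ≠ 0 ∧
              Ideal.span {G₀ * b} = Ideal.span {a} * D.charIdeal ∧
              Ideal.span {UnrSeries₂.plus Φ.G * PowerSeries.map Φ.J b} =
                Ideal.span {PowerSeries.map Φ.J a} *
                  (AcSelmer.XAc.charIdeal (V.baseChange K) p κ Φ.vbar ∅ Φ.γ₁).map (PowerSeries.map Φ.J))

/-- **XI″ — THE FOUR-TERM IDENTITIES OF `prop:equiv` AT A MEMBER OF THE CLASS, WITH NO `K`-TORSION HYPOTHESIS** (rev 5, the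
lattice-free PRE atom = XI′ with the conjunct `V(K)[p] = 0` deleted; long form of this docstring: memo Appendix G). Print's curve is
Wüthrich's `E_•` (CGS TeX l. 749–751) on EVERY census row: in the proof of Prop. 4.2.1 (TeX l. 1896–1941) `E_•(K)[p] = 0` is used only
to kill the compact `𝔖_{str,rel}` (l. 1924) and `𝔖_ord` (l. 1937), and both vanish by [TF] — `H¹(G_{K,Σ}, T_pE ⊗ Λ_K⁺)` is
`Λ_K⁺`-torsion-free for every non-CM `E/ℚ` (Kato, Astérisque 295 §13.8, pp. 227–228; `T_p(E(K_∞⁺)) = 0` by Imai). Companions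
`(V', g, ϖ, ϖ', D, G₀)` and the two identities as in XI′; `ι G₀ = 𝓛^PR(E_•/K)⁺` up to `ℤ_p^×` (Prop. 2.2.4). PRE rider unchanged
(⇐ Cor. 4.1.3 ⇐ Thm. 4.1.1 ⇐ BSTW §5). Why it might fail: only through the PRE rider.
[cite: CastellaGrossiSkinner2025, Prop. 4.2.1 (proof: (PT1) l. 1922, l. 1924; (PT2) l. 1933, l. 1937; (cc) l. 1907), Cor. 4.1.3, Thm. 4.1.1, Prop. 2.2.4]
[cite: Kato2004Asterisque, §13.8 (proof of Thm. 12.4 (2)), pp. 227–228] [cite: Imai1975, Theorem]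
[cite: BurungaleSkinnerTianWan2024, §5] -/
@[conjecture] def FourTermAtSomeLattice : Prop :=
  ∀ (W : WeierstrassCurve ℚ) [W.IsElliptic] [W.IsGloballyMinimal] (p : ℕ) [Fact p.Prime]
    (K : Type) [Field K] [NumberField K] (κ : ZpExtension K p) (γ : absoluteGaloisGroup K),
    NodeHyp W p K κ γ →
    ∀ [NeZero (W.conductorNorm ℤ)] (f : CuspForm (Gamma0 (W.conductorNorm ℤ)) 2), IsNewformOf W f →
    ∀ [NeZero (NumberField.discr K).natAbs] (Φ : FrameData W p K κ γ f) [Fact (κ.IsTopGenerator Φ.γ₁)],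
    ∃ (V : WeierstrassCurve ℚ) (_ : V.IsElliptic) (_ : V.IsGloballyMinimal),
      IsIsogenous W V ∧ Good V p ∧ Red V p ∧ SatisfiesHeegnerHypothesis (V.conductorNorm ℤ) K ∧
      (UnrSeries₂.plus Φ.G ≠ 0 →
        ∀ (V' : WeierstrassCurve ℚ) [V'.IsElliptic] [V'.IsGloballyMinimal],
          (∃ C : VariableChange ℚ, C • V' = V.quadraticTwist (NumberField.discr K : ℚ)) →
        ∀ [NeZero (V'.conductorNorm ℤ)] (g : CuspForm (Gamma0 (V'.conductorNorm ℤ)) 2), IsNewformOf V' g →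
        ∀ (ϖ : ℚ), (ϖ : ℝ) * V.realPeriodRat = plusPeriod f →
        ∀ (ϖ' : ℚ), (ϖ' : ℝ) * V'.realPeriodRat = plusPeriod g →
        ∀ (D : (V.baseChange K).SelmerDualData κ γ) (G₀ : IwasawaAlgebra p),
          iwasawaToPowerSeries p G₀ =
            PowerSeries.C ((ϖ * ϖ' : ℚ) : ℚ_[p]) *
              (padicLFunction f (unitRoot V p : ℚ_[p]) * padicLFunction g (unitRoot V' p : ℚ_[p])) →
          (D.IsTorsion ∨
              Module.IsTorsion (IwasawaAlgebra p) (AcSelmer.XAc (V.baseChange K) p κ Φ.vbar ∅ Φ.γ₁)) →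
          D.IsTorsion ∧
            Module.IsTorsion (IwasawaAlgebra p) (AcSelmer.XAc (V.baseChange K) p κ Φ.vbar ∅ Φ.γ₁) ∧
            ∃ a b : IwasawaAlgebra p, a ≠ 0 ∧ b ≠ 0 ∧
              Ideal.span {G₀ * b} = Ideal.span {a} * D.charIdeal ∧
              Ideal.span {UnrSeries₂.plus Φ.G * PowerSeries.map Φ.J b} =
                Ideal.span {PowerSeries.map Φ.J a} *
                  (AcSelmer.XAc.charIdeal (V.baseChange K) p κ Φ.vbar ∅ Φ.γ₁).map (PowerSeries.map Φ.J))

/-- **XI° — the two divisibility transfers of `prop:equiv` at a member of the class, with no `K`-torsion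
hypothesis** (= XI with the conjunct `V(K)[p] = 0` deleted; PROVED below from XI″ by the same elimination,
`crossTransferSome_of_fourTermSome`). [cite: CastellaGrossiSkinner2025, Prop. 4.2.1, §5 Steps 2–3] -/
@[conjecture] def CrossTransferAtSomeLattice : Prop :=
  ∀ (W : WeierstrassCurve ℚ) [W.IsElliptic] [W.IsGloballyMinimal] (p : ℕ) [Fact p.Prime]
    (K : Type) [Field K] [NumberField K] (κ : ZpExtension K p) (γ : absoluteGaloisGroup K),
    NodeHyp W p K κ γ →
    ∀ [NeZero (W.conductorNorm ℤ)] (f : CuspForm (Gamma0 (W.conductorNorm ℤ)) 2), IsNewformOf W f →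
    ∀ [NeZero (NumberField.discr K).natAbs] (Φ : FrameData W p K κ γ f) [Fact (κ.IsTopGenerator Φ.γ₁)],
    ∃ (V : WeierstrassCurve ℚ) (_ : V.IsElliptic) (_ : V.IsGloballyMinimal),
      IsIsogenous W V ∧ Good V p ∧ Red V p ∧ SatisfiesHeegnerHypothesis (V.conductorNorm ℤ) K ∧
      (UnrSeries₂.plus Φ.G ≠ 0 →
        ∀ (V' : WeierstrassCurve ℚ) [V'.IsElliptic] [V'.IsGloballyMinimal],
          (∃ C : VariableChange ℚ, C • V' = V.quadraticTwist (NumberField.discr K : ℚ)) →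
        ∀ [NeZero (V'.conductorNorm ℤ)] (g : CuspForm (Gamma0 (V'.conductorNorm ℤ)) 2), IsNewformOf V' g →
        ∀ (ϖ : ℚ), (ϖ : ℝ) * V.realPeriodRat = plusPeriod f →
        ∀ (ϖ' : ℚ), (ϖ' : ℝ) * V'.realPeriodRat = plusPeriod g →
        ∀ (D : (V.baseChange K).SelmerDualData κ γ) (G₀ : IwasawaAlgebra p),
          iwasawaToPowerSeries p G₀ =
            PowerSeries.C ((ϖ * ϖ' : ℚ) : ℚ_[p]) *
              (padicLFunction f (unitRoot V p : ℚ_[p]) * padicLFunction g (unitRoot V' p : ℚ_[p])) →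
          (D.IsTorsion → G₀ ∈ D.charIdeal →
            Ideal.span {UnrSeries₂.plus Φ.G} ≤
              (AcSelmer.XAc.charIdeal (V.baseChange K) p κ Φ.vbar ∅ Φ.γ₁).map (PowerSeries.map Φ.J)) ∧
          (Module.IsTorsion (IwasawaAlgebra p) (AcSelmer.XAc (V.baseChange K) p κ Φ.vbar ∅ Φ.γ₁) →
            (AcSelmer.XAc.charIdeal (V.baseChange K) p κ Φ.vbar ∅ Φ.γ₁).map (PowerSeries.map Φ.J) ≤
              Ideal.span {UnrSeries₂.plus Φ.G} →
            D.charIdeal ≤ Ideal.span {G₀}))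

/-- **K2⁺ — ISOGENY INVARIANCE OF `char 𝔛_Gr(·/K_∞⁺)` on the CYCLOTOMIC line** (Perrin-Riou's `μ`-formula for the Greenberg structure;
long forms: memo Appendices E and H). Token-for-token the tree's anticyclotomic fact `KobayashiOta2020.prop29_charIdeal_XGr_anticyclotomic_eq_of_isIsogenous`
with `κ.IsCyclotomic`: for rationally isogenous `W₁ ∼ W₂`, `𝔛_Gr(W₂/K_∞⁺)` is torsion once `𝔛_Gr(W₁/K_∞⁺)` is, with the SAME characteristic
ideal. Print: the duals differ by `p^{μ₂−μ₁}` and Perrin-Riou's Théorème (ASPM 17, p. 349) / Kobayashi–Ota (ASPM 86, proof of Prop. 2.9,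
p. 552, footnote 1) give `μ₂ − μ₁ = m − m − 0 = 0` for (relaxed `v`, strict `v̄`). STATUS: NOT a tree fact (typing p617858 REFUSED: one index
at every `v ∣ p` in Perrin-Riou); superseded in this file by K2⁺-e (PROVED) ⊕ K2⁺-μ (roads A/B).
[cite: PerrinRiou1989ASPM, Théorème (p. 349), §1 (pp. 348–349), §3] [cite: Schneider1987MuIsogenies, Theorem] [cite: KobayashiOta2020, Prop. 2.9, proof and footnote 1 (p. 552)]
[cite: CastellaGrossiSkinner2025, Def. 3.1.1, (cc) (TeX l. 1907), remark after Prop. 3.2.3 (l. 1241–1243)] -/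
@[conjecture] def XGrCharIdealIsogenyInvariantCyc : Prop :=
  ∀ (W₁ W₂ : WeierstrassCurve ℚ) [W₁.IsElliptic] [W₁.IsGloballyMinimal] [W₂.IsElliptic]
    [W₂.IsGloballyMinimal] (p : ℕ) [Fact p.Prime],
    2 < p → W₁.HasGoodReductionAtPrime p → IsIsogenous W₁ W₂ →
    ∀ (K : Type) [Field K] [NumberField K], IsImaginaryQuadratic K →
      SatisfiesHeegnerHypothesis (W₁.conductorNorm ℤ) K → SatisfiesHeegnerHypothesis p K →
      Odd (NumberField.discr K) → NumberField.discr K ≠ -3 →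
    ∀ (v vbar : HeightOneSpectrum (𝓞 K)),
      ((p : ℕ) : 𝓞 K) ∈ v.asIdeal → ((p : ℕ) : 𝓞 K) ∈ vbar.asIdeal → vbar ≠ v →
    ∀ (κ : ZpExtension K p), κ.IsCyclotomic →
    ∀ (γ : absoluteGaloisGroup K) [Fact (κ.IsTopGenerator γ)],
      Module.IsTorsion (IwasawaAlgebra p) (AcSelmer.XAc (W₁.baseChange K) p κ vbar ∅ γ) →
      Module.IsTorsion (IwasawaAlgebra p) (AcSelmer.XAc (W₂.baseChange K) p κ vbar ∅ γ) ∧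
      AcSelmer.XAc.charIdeal (W₁.baseChange K) p κ vbar ∅ γ =
        AcSelmer.XAc.charIdeal (W₂.baseChange K) p κ vbar ∅ γ

/-- **K2⁺-e — ISOGENY INVARIANCE OF `𝔛_Gr(·/K_∞⁺)` AWAY FROM `(p)`** (rev 6 = g11; PROVED REV 7 = g13: `xGrIsogenyAwayFromP_proved`,
§K2e, sorry-free; long form of this docstring: memo Appendix F). Same binders as K2⁺; conclusion: `𝔛_Gr(W₂/K_∞⁺)` is `Λ`-torsion once
`𝔛_Gr(W₁/K_∞⁺)` is, and the two duals have the same `Module.lengthAt` at every height-one `𝔮 ≠ (p) = IwasawaAlgebra.augIdealP p`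
(equal `λ`-parts: the characteristic ideals «differ only by multiplication by a power of `p`», Greenberg, LNM 1716, §1, paragraph
before Conj. 1.11 [corpus: book:coates1999-arithmetic-theory-elliptic-curves p0064]; *Iwasawa theory for motives* §3 [corpus:
book:editornd-l-functions-arithmetic p0186]; Greenberg–Vatsal §2 p. 28). Kernel route: `φ`, `φ̂` induce `h1Map`s
(`IsogenySelmerInfty` §2) respecting the local kernels of `AcSelmer.selmerOver`, hence `Λ`-linear maps `𝔛(W₂) ⇄ 𝔛(W₁)` with both
composites `= deg φ`, a unit at every `𝔮 ∌ p`. [cite: GreenbergLNM1716, §1 (paragraph before Conj. 1.11)]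
[cite: Greenberg1991, §3 (p. 219)] [cite: GreenbergVatsal2000, §2 (p. 28)] -/
@[conjecture] def XGrIsogenyInvariantAwayFromP : Prop :=
  ∀ (W₁ W₂ : WeierstrassCurve ℚ) [W₁.IsElliptic] [W₁.IsGloballyMinimal] [W₂.IsElliptic]
    [W₂.IsGloballyMinimal] (p : ℕ) [Fact p.Prime],
    2 < p → W₁.HasGoodReductionAtPrime p → IsIsogenous W₁ W₂ →
    ∀ (K : Type) [Field K] [NumberField K], IsImaginaryQuadratic K →
      SatisfiesHeegnerHypothesis (W₁.conductorNorm ℤ) K → SatisfiesHeegnerHypothesis p K →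
      Odd (NumberField.discr K) → NumberField.discr K ≠ -3 →
    ∀ (v vbar : HeightOneSpectrum (𝓞 K)),
      ((p : ℕ) : 𝓞 K) ∈ v.asIdeal → ((p : ℕ) : 𝓞 K) ∈ vbar.asIdeal → vbar ≠ v →
    ∀ (κ : ZpExtension K p), κ.IsCyclotomic →
    ∀ (γ : absoluteGaloisGroup K) [Fact (κ.IsTopGenerator γ)],
      Module.IsTorsion (IwasawaAlgebra p) (AcSelmer.XAc (W₁.baseChange K) p κ vbar ∅ γ) →
      Module.IsTorsion (IwasawaAlgebra p) (AcSelmer.XAc (W₂.baseChange K) p κ vbar ∅ γ) ∧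
      ∀ 𝔮 : PrimeSpectrum (IwasawaAlgebra p), 𝔮.asIdeal.height = 1 →
        𝔮.asIdeal ≠ IwasawaAlgebra.augIdealP p →
        Literature.NumberTheory.EllipticCurves.Module.lengthAt (IwasawaAlgebra p)
            (AcSelmer.XAc (W₁.baseChange K) p κ vbar ∅ γ) 𝔮 =
          Literature.NumberTheory.EllipticCurves.Module.lengthAt (IwasawaAlgebra p)
            (AcSelmer.XAc (W₂.baseChange K) p κ vbar ∅ γ) 𝔮

/-- **K2⁺-μ — `μ`-INVARIANCE OF `𝔛_Gr(·/K_∞⁺)` UNDER A `ℚ`-ISOGENY** (rev 6 = generation 11: THE residual un-printed input of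
the K2⁺ branch, isolated). Same binders as K2⁺; conclusion: the tree's `muInvariant` (local length at `(p)`) of `𝔛_Gr(W₁/K_∞⁺)` and
of `𝔛_Gr(W₂/K_∞⁺)` coincide (Greenberg structure: relaxed at `v`, strict at `v̄`; CYCLOTOMIC `κ`). With K2⁺-e this is K2⁺
(`xGrIsogenyInvariantCyc_of_pieces`, sorry-free). WHY `0` (measured, g11; long forms with every page hit: memo Appendices B and I,
card «K2⁺-μ»): the datum `(A, A_v = A, A_v̄ = 0)` on `A = E[p^∞]` over an imaginary quadratic `K` with `p = v v̄` is BALANCED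
(`(2−2)·1 + (2−0)·1 = 2 = 2·r₂(K)`, Lim 2017 §3 (a)–(d) [corpus: paper:arxiv-1409.0942 p0011–p0012]), so the printed `μ`-variation
formula of the Euler-characteristic method (Perrin-Riou, BSMF 115 (1987), Appendice, THÉORÈME p. 448 [corpus: paper:doi-10-24033-bsmf-2085
p0051–p0052]; = Schneider 1987; over `ℚ` quoted arXiv:2308.06673 Thm. 6.1 [corpus: paper:arxiv-2308.06673 p0015]; Greenberg LNM 1716 §1
[corpus: book:coates1999-… p0064]) evaluates to `m(f) = c + 0 + c − 2c = 0` for EVERY kernel — the evaluation printed by Kobayashi–Ota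
(ASPM 86, proof of Prop. 2.9, p. 552, footnote 1). PRINT LEDGER: Drinen, JNT 102 (2003) Thm. 1.2 + §2 Def. 2.1 / eq. (7) [corpus:
paper:doi-10-1016-s0022-314x-03-00105-7 p0003, p0006–p0008] (`K_∞` cyclotomic, `p` odd, `S_A`, `S_{A*}` cotorsion — the
`Module.IsTorsion` binder; critic V78 N3; Drinen 2002 NOT HELD, acq-10876); PROOF-BEARING: Arnold–Koo, Doc. Math. 16 (2011) Thm. 4.4
(p. 895) with the `(p)`-critical cancellation of their Thm. 5.3 (p. 897) [corpus: paper:doi-10-4171-dm-354, prose only — full PDF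
acq-14269]; hypothesis ledger (2.8.1)–(2.8.6), exceptional sub-locus `χ = 1` (V78 N1), `(p)`-length-0 items (V78 N2): memo §3–§5;
Ochiai (2008) acq-14268. ROAD B (§K2μ-B below, REV 8–8.5): residual `GL(1)` finiteness by Ferrero–Washington instead of a variation
formula — typed input `ResidualGL1FinitenessOdd`; everything else PROVED except `RoadBResidueP` ((B1c) at degree `p`); no exceptional
sub-locus, no cotorsion of the contragredient. LOAD-BEARING DIRECTION: downstream (`memberValue_of_someLattice` → `stepsTwoThree_core`,
Step 3 at `T = 0`) only `μ(𝔛_Gr(V/K_∞⁺)) ≥ μ(𝔛_Gr(E₀/K_∞⁺))` is consumed. Why it might fail: a local term at a place above `p` that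
does not cancel for place-dependent data (the computation says it cancels identically); junk: like K2⁺, stated without `Module.Finite`.
[cite: PerrinRiou1987BSMF, Appendice, Théorème] [cite: Schneider1987MuIsogenies, Theorem] [cite: PerrinRiou1989ASPM, Théorème (p. 349)]
[cite: GreenbergLNM1716, §1] [cite: Lim2017ComparingPi, §3 (a)–(d), §3.1 Lemma] [cite: KobayashiOta2020, Prop. 2.9, proof and footnote 1 (p. 552)]
[cite: Drinen2003, Thm. 1.2, Thm. 1.1, §2 eq. (5)–(7), Def. 2.1] [cite: Drinen2002, Thm. 3.6, Thm. 3.7 (hypotheses of Thm. 1.1; not held)]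
[cite: ArnoldKoo2011, Thm. 4.4, §2.3, §2.8 (2.8.1)–(2.8.6), Thm. 3.2, Lemma 3.10, Prop. 4.3, proof of Thm. 5.3 (p. 897)] -/
@[conjecture] def XGrMuIsogenyInvariantCyc : Prop :=
  ∀ (W₁ W₂ : WeierstrassCurve ℚ) [W₁.IsElliptic] [W₁.IsGloballyMinimal] [W₂.IsElliptic]
    [W₂.IsGloballyMinimal] (p : ℕ) [Fact p.Prime],
    2 < p → W₁.HasGoodReductionAtPrime p → IsIsogenous W₁ W₂ →
    ∀ (K : Type) [Field K] [NumberField K], IsImaginaryQuadratic K →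
      SatisfiesHeegnerHypothesis (W₁.conductorNorm ℤ) K → SatisfiesHeegnerHypothesis p K →
      Odd (NumberField.discr K) → NumberField.discr K ≠ -3 →
    ∀ (v vbar : HeightOneSpectrum (𝓞 K)),
      ((p : ℕ) : 𝓞 K) ∈ v.asIdeal → ((p : ℕ) : 𝓞 K) ∈ vbar.asIdeal → vbar ≠ v →
    ∀ (κ : ZpExtension K p), κ.IsCyclotomic →
    ∀ (γ : absoluteGaloisGroup K) [Fact (κ.IsTopGenerator γ)],
      Module.IsTorsion (IwasawaAlgebra p) (AcSelmer.XAc (W₁.baseChange K) p κ vbar ∅ γ) →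
      muInvariant p (AcSelmer.XAc (W₁.baseChange K) p κ vbar ∅ γ) =
        muInvariant p (AcSelmer.XAc (W₂.baseChange K) p κ vbar ∅ γ)

/-- **MV — what Steps 2–3 actually consume: ONE member `V ∼ E` carrying BOTH the Step-1 value of
`char 𝔛_Gr(V/K_∞⁺)` AND the two transfers of `prop:equiv`.** At the node, for a frame `Φ`, there is `V ∼ E`
(`Good/Red/Heeg(N_V)`) with `𝔛_Gr(V/K_∞⁺)` torsion, `char = (F)`, `F(0) ≠ 0`, `‖F(0)‖ = ‖𝓛_Gr⁺(0)‖`, and —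
when `𝓛_Gr⁺ ≠ 0` — the transfer block of XI/XI° at `V`. Two roads to MV are proved below: the torsion-free
road of rev 1–4 (`V = E_▵` of XI, Step 1 at `V` itself) and the lattice-free road of rev 5 (`V = E_•` of XI°,
Step 1 at the good lattice `E₀`, moved to `V` by K2⁺). [cite: CastellaGrossiSkinner2025, §5 Steps 1–3] -/
@[conjecture] def MemberValueAndTransfers : Prop :=
  ∀ (W : WeierstrassCurve ℚ) [W.IsElliptic] [W.IsGloballyMinimal] (p : ℕ) [Fact p.Prime]
    (K : Type) [Field K] [NumberField K] (κ : ZpExtension K p) (γ : absoluteGaloisGroup K),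
    NodeHyp W p K κ γ →
    ∀ [NeZero (W.conductorNorm ℤ)] (f : CuspForm (Gamma0 (W.conductorNorm ℤ)) 2), IsNewformOf W f →
    ∀ [NeZero (NumberField.discr K).natAbs] (Φ : FrameData W p K κ γ f) [Fact (κ.IsTopGenerator Φ.γ₁)],
    ∃ (V : WeierstrassCurve ℚ) (_ : V.IsElliptic) (_ : V.IsGloballyMinimal),
      IsIsogenous W V ∧ Good V p ∧ Red V p ∧ SatisfiesHeegnerHypothesis (V.conductorNorm ℤ) K ∧
      (Module.IsTorsion (IwasawaAlgebra p) (AcSelmer.XAc (V.baseChange K) p κ Φ.vbar ∅ Φ.γ₁) ∧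
        ∃ F : IwasawaAlgebra p,
          AcSelmer.XAc.charIdeal (V.baseChange K) p κ Φ.vbar ∅ Φ.γ₁ = Ideal.span {F} ∧
          PowerSeries.constantCoeff F ≠ 0 ∧
          ‖(((PowerSeries.constantCoeff F : ℤ_[p]) : ℚ_[p]) : ℂ_[p])‖ =
            ‖((PowerSeries.constantCoeff (UnrSeries₂.plus Φ.G) : PadicComplexInt p) : ℂ_[p])‖) ∧
      (UnrSeries₂.plus Φ.G ≠ 0 →
        ∀ (V' : WeierstrassCurve ℚ) [V'.IsElliptic] [V'.IsGloballyMinimal],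
          (∃ C : VariableChange ℚ, C • V' = V.quadraticTwist (NumberField.discr K : ℚ)) →
        ∀ [NeZero (V'.conductorNorm ℤ)] (g : CuspForm (Gamma0 (V'.conductorNorm ℤ)) 2), IsNewformOf V' g →
        ∀ (ϖ : ℚ), (ϖ : ℝ) * V.realPeriodRat = plusPeriod f →
        ∀ (ϖ' : ℚ), (ϖ' : ℝ) * V'.realPeriodRat = plusPeriod g →
        ∀ (D : (V.baseChange K).SelmerDualData κ γ) (G₀ : IwasawaAlgebra p),
          iwasawaToPowerSeries p G₀ =
            PowerSeries.C ((ϖ * ϖ' : ℚ) : ℚ_[p]) *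
              (padicLFunction f (unitRoot V p : ℚ_[p]) * padicLFunction g (unitRoot V' p : ℚ_[p])) →
          (D.IsTorsion → G₀ ∈ D.charIdeal →
            Ideal.span {UnrSeries₂.plus Φ.G} ≤
              (AcSelmer.XAc.charIdeal (V.baseChange K) p κ Φ.vbar ∅ Φ.γ₁).map (PowerSeries.map Φ.J)) ∧
          (Module.IsTorsion (IwasawaAlgebra p) (AcSelmer.XAc (V.baseChange K) p κ Φ.vbar ∅ Φ.γ₁) →
            (AcSelmer.XAc.charIdeal (V.baseChange K) p κ Φ.vbar ∅ Φ.γ₁).map (PowerSeries.map Φ.J) ≤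
              Ideal.span {UnrSeries₂.plus Φ.G} →
            D.charIdeal ≤ Ideal.span {G₀}))

/-- **ISO — transport of the node's conclusion along the isogeny class over `K_∞⁺`** (plumbing, PUB-derived):
the Thm. 7.2.3-shape conclusion for `V/K_∞⁺` (a member `V ∼ E`) implies it for `E/K_∞⁺`, for the common
newform `f`. In print: "by Prop. 3.2.3 it suffices to prove the result for the isogenous curve" (CGS TeX
l. 2190, PR87 Appendice Lemme); in the tree: Prop. 3.3.1 (`char X_ord(·/K_∞⁺) = char X(·/ℚ_∞)·char X(·'/ℚ_∞)`)
at `V` and at `E`, Prop. 3.2.3 over `ℚ_∞` (`prop323_charGenerator_eq_of_isIsogenous`, which also yields the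
period ratio `Ω_E = r Ω_V`) for `E ∼ V` and `E' ∼ V'`, Kato–Wuthrich torsion. [cite: CastellaGrossiSkinner2025, Prop. 3.2.3, Prop. 3.3.1, §6 (TeX l. 2190)]
[cite: PerrinRiou1987BSMF, Appendice, Lemme (p. 455)] -/
@[conjecture] def IsoTransportK : Prop :=
  ∀ (W : WeierstrassCurve ℚ) [W.IsElliptic] [W.IsGloballyMinimal] (p : ℕ) [Fact p.Prime]
    (K : Type) [Field K] [NumberField K] (κ : ZpExtension K p) (γ : absoluteGaloisGroup K),
    NodeHyp W p K κ γ →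
    ∀ [NeZero (W.conductorNorm ℤ)] (f : CuspForm (Gamma0 (W.conductorNorm ℤ)) 2), IsNewformOf W f →
    ∀ (V : WeierstrassCurve ℚ) [V.IsElliptic] [V.IsGloballyMinimal], IsIsogenous W V →
      Good V p → Red V p →
      NodeConcl V p K κ γ f → NodeConcl W p K κ γ f


/-! ## Road B currencies (K2⁺-μ by residual `GL(1)` finiteness) -/

/-- **ROAD B input (B3) — `GL1-res(K)` at odd `p` for characters coming from `ℚ`** (`ResidualGL1FinitenessOdd`; nothing asserted;
idea-11 REV 8). For an imaginary quadratic `K`, an odd prime `p = v v̄` SPLIT in `K`, the CYCLOTOMIC `ℤ_p`-extension `κ`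
(`K_∞⁺ = K̄^{ker κ}`), a finite set `S` of finite places, and a discrete module `M` of order `p` whose `Γ_K`-action is the
restriction along `absGaloisRestrict ℚ K : Γ_K →* Γ_ℚ` of a `Γ_ℚ`-action (an `𝔽_p`-character OF `G_ℚ`): the residual Greenberg
Selmer group `GreenbergVatsal2000.datumStrictSelmer (ker κ) M p (AcSelmer.bdpData M p v̄) S` — classes of `H¹(K_∞⁺, M)` unramified
outside `S ∪ {w ∣ p}`, NO condition at `S` and above `v`, ZERO on the decomposition groups above `v̄` — is FINITE. Same carriers as
`CastellaGrossiLeeSkinner2022.prop14_residualCharacterSelmer_finite` (anticyclotomic twin, with a proviso not needed here).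
Expected proof: Ferrero–Washington (`IwasawaTheory.ferreroWashington1979_classicalMuVanishes`) for `K·ℚ(η)` and
`(K·ℚ(η))^+(μ_p)`, Kummer duality, weak Leopoldt (`IwasawaTheory.weakLeopoldt_H2_subsingleton_cyclotomic_of_isOpen`), Leopoldt
for abelian fields (Brumer) to make `X_{Σ_v}((Kℚ(η))_∞)` torsion, CFT. Why it might fail: only through a slip in the unit
bookkeeping at the `v`-places — WITHOUT the provenance hypothesis the statement is Iwasawa's `μ`-conjecture for abelian extensions
of `K` (open); junk: none (non-continuous actions make `subgroupH1` vanish).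
[cite: GreenbergLNM1716, Prop. 5.10 (proof)] [cite: FerreroWashington1979, Theorem] [cite: Washington1997, §13.5]
[cite: CastellaGrossiLeeSkinner2022, §1.2 Prop. 14 (shape)] [cite: GreenbergVatsal2000, §2 pp. 15, 20 (the Selmer datum)] -/
@[conjecture] def ResidualGL1FinitenessOdd : Prop :=
  ∀ (K : Type) [Field K] [NumberField K], IsImaginaryQuadratic K →
    ∀ (p : ℕ) [Fact p.Prime], p ≠ 2 →
    ∀ (κ : ZpExtension K p), κ.IsCyclotomic →
    ∀ (v vbar : HeightOneSpectrum (𝓞 K)), ((p : ℕ) : 𝓞 K) ∈ v.asIdeal → ((p : ℕ) : 𝓞 K) ∈ vbar.asIdeal →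
      vbar ≠ v →
    ∀ (S : Set (HeightOneSpectrum (𝓞 K))), S.Finite →
    ∀ (M : Type) [AddCommGroup M] [DistribMulAction (absoluteGaloisGroup ℚ) M]
      [DistribMulAction (absoluteGaloisGroup K) M] [TopologicalSpace M] [DiscreteTopology M],
      Nat.card M = p →
      (∀ (σ : absoluteGaloisGroup K) (m : M), σ • m = (absGaloisRestrict ℚ K σ) • m) →
      (GreenbergVatsal2000.datumStrictSelmer κ.kerSubgroup M p (AcSelmer.bdpData M p vbar) S :
        Set (subgroupH1 κ.kerSubgroup M)).Finite

/-- **(B1c) for ONE `ℚ`-isogeny of degree EXACTLY `p`, as a TYPE** (`KerSelmerMapFiniteOfDegreeP`; nothing asserted; idea-11 REV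
8.5, critic V86 N2; v8: `K2e.acSelmerMap` is the TREE def of `Theorems/…InterludeSelmerIsogenyMaps.lean`): for elliptic `W, W'`
over `ℚ` with good reduction at an odd prime `p` (model-independent `HasGoodReductionAtPrime`; no minimality binders), a
`ℚ`-isogeny `ψ₀ : W → W'` of degree `p`, an imaginary quadratic `K` with `p = v v̄` and the cyclotomic `κ`: `Sel_v̄(K_∞⁺, ψ₀/K)`
(`K2e.acSelmerMap` of `ψ₀.extendScalars K`) has FINITE kernel. Road B's proof: `ker Sel(ψ₀/K) ⊆ ι_* R♯(W[ψ₀])`,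
`R♯/R ↪ ⊕_{u ∣ v̄} W'[p^∞](K_{∞,u})/ψ₀(…)` finite (input-free: companion workfile (R3-alg)/CL), `R(W[ψ₀])` = an instance of
`ResidualGL1FinitenessOdd` (`#W[ψ₀] = p`, `Γ_ℚ`-action `Isogeny.kerAction`, `S` = bad places). Why it might fail: only through (B3).
[cite: GreenbergLNM1716, §5, proof of Prop. 5.10] [folklore] -/
@[conjecture] def KerSelmerMapFiniteOfDegreeP : Prop :=
  ∀ (W W' : WeierstrassCurve ℚ) [W.IsElliptic] [W'.IsElliptic] (p : ℕ) [Fact p.Prime],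
    2 < p → W.HasGoodReductionAtPrime p → W'.HasGoodReductionAtPrime p →
    ∀ (ψ₀ : Isogeny W W'), ψ₀.degree = p →
    ∀ (K : Type) [Field K] [NumberField K], IsImaginaryQuadratic K →
    ∀ (v vbar : HeightOneSpectrum (𝓞 K)),
      ((p : ℕ) : 𝓞 K) ∈ v.asIdeal → ((p : ℕ) : 𝓞 K) ∈ vbar.asIdeal → vbar ≠ v →
    ∀ (κ : ZpExtension K p), κ.IsCyclotomic →
      Finite (Summit.BirchSwinnertonDyer.BirchSwinnertonDyer.Theorems.InterludeWithTorsion.K2e.acSelmerMap p κ vbar ∅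
        (ψ₀.extendScalars K).toAddMonoidHom (ψ₀.extendScalars K).equivariant).ker

/-- **What road B owes, as a TYPE** (`RoadBResidueP`; idea-11 REV 8.5): residual `GL(1)` finiteness ⟹ finite Selmer kernel along
ONE `ℚ`-isogeny of degree EXACTLY `p`. Nothing asserted. [cite: GreenbergLNM1716, §5, proof of Prop. 5.10] -/
@[conjecture] def RoadBResidueP : Prop := ResidualGL1FinitenessOdd → KerSelmerMapFiniteOfDegreeP

end Summit.BirchSwinnertonDyer.BirchSwinnertonDyer.Theorems.InterludeWithTorsion

end
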